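import Summits.BirchSwinnertonDyer.BirchSwinnertonDyer.Theorems.SignedLowerHalvesSmallImageLowerHalfBothSignsLambdaLowerThreeNsThetaPartnerFrame
import Literature.NumberTheory.Automorphic.ArtinLFunctionsAbelianConductorProofs
import Literature.NumberTheory.GaloisRepresentations.HeckeCharacterGaloisAvatarProofs
import Literature.NumberTheory.GaloisRepresentations.TeichmullerLiftMonomial
import Literature.NumberTheory.GaloisRepresentations.AbsIntegersEquiv
import Literature.NumberTheory.EllipticCurves.GaloisActionProofs
import Literature.NumberTheory.EllipticCurves.SupersingularDensitySerreTraceProofs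
import Literature.FieldTheory.AlgClosed.PadicAlgClEquivComplex
import HarnessLib

/-!
# The Artin character `χ = Teich ∘ j ∘ Φ ∘ ρ̄ ∘ res_{K/ℚ}` of the dihedral constituent and its Hecke character
# (class field theory for `K`; bricks S3–S4 of the odd-`p` Hecke theta partner)

Route `SignedLowerHalves`, child L `SmallImageLowerHalfBothSigns` (item stmt-BirchSwinnertonDyer-23599), line
proposal `rtt_w3`, stub K0₂@p `stub_heckeThetaPartner_ns` — bricks S3 (the Artin character) and S4 (its Hecke
character) of the arithmetic half at an ODD prime (width seat `bsd-line-slh-p3-w3` gen 9; memo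
`Lines/birth_acns-MEMO-w3-g9.md`).  THEOREMS ONLY (no definition, no named fact, no `sorry`); ROUTE-INDEPENDENT.

Setting: `E = W/ℚ` elliptic, `p` a prime, a frame `Φ` of `E[p]`, a field `k ⊆ M₂(𝔽_p)` of degree `2`, a number
field `K` whose absolute Galois group lands in `U = ρ̄⁻¹(Φ⁻¹(kˣ))` under `res_{K/ℚ}` (hypothesis `hKU`; the
dihedral field), a ring homomorphism `j : k → k̄_p = ℤ̄_p/𝔪` (bricks ORIENT-G), and `e : ℚ̄_p ≃ ℂ`.  Then
`τ ↦ e(Teich(j(Φ(ρ̄(res τ)))))` — the Teichmüller lift (tree `exists_teichmullerSection`, order `p² − 1`, prime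
to `p`) of the `k̄_p`-valued character `χ̄_K = j ∘ Φ ∘ ρ̄ ∘ res` of `Γ_K` — is a continuous character
`Γ_K → ℂˣ` with open kernel, i.e. a rank-one Artin representation of `K`:

* `pow_card_sub_one_eq_one_of_mem` — `y^{p²−1} = 1` for `y ∈ kˣ` (`#k = p²`);
* **`exists_framedArtinRep_teichmuller`** — there is `χ : FramedArtinRep K 1` with
  `det χ(τ) = e(T(j(Φ(ρ̄(res τ)))))` for all `τ ∈ Γ_K`, `T` a Teichmüller section of exponent `p² − 1`
  (`T z` is a `(p²−1)`-th root of unity with residue `z`), together with: `χ` is unramified at every place of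
  `K` above a good prime `ℓ ≠ p` of `W` (`E[p]` is unramified there, `galoisRepTorsion_eq_one_of_mem_inertia_prime`;
  `res` maps inertia to inertia, `absGaloisRestrict_mem_inertia_comap`), and the `e`-adic reading
  `‖e⁻¹(det χ τ)‖ = 1`, `residue(e⁻¹(det χ τ)) = j(Φρ̄(res τ))`;
* **`exists_heckeCharacter_teichmuller`** — by the tree's Artin reciprocity
  (`Automorphic.artinReciprocity_character_primitive_holds`: global class field theory, PROVED in the tree) there
  is a finite-order Hecke character `η` of `K`, unramified exactly where `χ` is, with
  `η(ϖ_v) = e(T(j(Φ(ρ̄(res Frob_v)))))` at every such place — the prime-value function `χ̃` of the CM theta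
  partner before the type-`(1,0)` twist (bricks S6–S8).

BSD, crux L and the stub are NOT proved here.

References: J. Tate, *Global class field theory* (Cassels–Fröhlich VII) §5; J. Neukirch, ANT VII (10.6), VI (6.6);
J.-P. Serre, *Local Fields* II §4 Prop. 8 (Teichmüller representatives); Invent. Math. 15 (1972) §4.2 c).
-/

set_option autoImplicit false
set_option linter.dupNamespace false

noncomputable section

open scoped Classical NumberField MatrixGroups
open IsDedekindDomain Field Matrix NumberField WeierstrassCurve Literature.NumberTheory.EllipticCurves
  Literature.NumberTheory.GaloisRepresentations Rat.HeightOneSpectrum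
  Literature.NumberTheory.EllipticCurves.Rank1Residual Polynomial

namespace Summit.BirchSwinnertonDyer.BirchSwinnertonDyer.Theorems.SmallImageLambdaLowerThreeNsThetaPartner

universe u

/-! ### §1. `y^{p²−1} = 1` in the field `k` of `p²` elements -/

/-- In a field `k ⊆ M₂(𝔽_p)` of degree `2` every non-zero element satisfies `y^{p²−1} = 1`. [folklore] -/
theorem pow_card_sub_one_eq_one_of_mem {p : ℕ} [Fact p.Prime]
    {k : Subalgebra (ZMod p) (Matrix (Fin 2) (Fin 2) (ZMod p))} (hk : IsField k)
    (h2 : Module.finrank (ZMod p) k = 2) (y : k) (hy : y ≠ 0) : y ^ (p ^ 2 - 1) = 1 := by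
  letI : Field k := hk.toField
  letI : Fintype k := Fintype.ofFinite k
  have hcard : Fintype.card k = p ^ 2 := by
    rw [Module.card_eq_pow_finrank (K := ZMod p) (V := k), ZMod.card, h2]
  rw [← hcard]
  exact FiniteField.pow_card_sub_one_eq_one y hy

/-- The same for the unit `Φ(g) ∈ kˣ` read as an element of `k`. [folklore] -/
theorem pow_card_sub_one_coe_eq_one {p : ℕ} [Fact p.Prime]
    {k : Subalgebra (ZMod p) (Matrix (Fin 2) (Fin 2) (ZMod p))} (hk : IsField k)
    (h2 : Module.finrank (ZMod p) k = 2) {g : GL (Fin 2) (ZMod p)} (hg : g ∈ Serre1972.unitGroup k) :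
    (⟨(g : Matrix (Fin 2) (Fin 2) (ZMod p)), hg⟩ : k) ^ (p ^ 2 - 1) = 1 := by
  refine pow_card_sub_one_eq_one_of_mem hk h2 _ fun h0 => ?_
  have h := congrArg Subtype.val h0
  simp only [ZeroMemClass.coe_zero] at h
  exact (GL2.det_ne_zero g) (by rw [h, Matrix.det_zero])

/-! ### §2. The Artin character of `K` -/

section Artin

variable (W : WeierstrassCurve ℚ) [W.IsElliptic] (p : ℕ) [Fact p.Prime]
  (Φ : Multiplicative (AddAut (geomTorsion W p)) ≃* GL (Fin 2) (ZMod p))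
  {k : Subalgebra (ZMod p) (Matrix (Fin 2) (Fin 2) (ZMod p))}
  (K : Type) [Field K] [NumberField K]

/-- **The Artin character `χ = e ∘ Teich ∘ j ∘ Φ ∘ ρ̄ ∘ res_{K/ℚ}` of `K`.**  See the module docstring.
Conclusions: a Teichmüller section `T` of exponent `p² − 1` (`T z` is a `(p²−1)`-th root of unity in `ℤ̄_p` with
residue `z` whenever `z^{p²−1} = 1`); the value formula `det χ(τ) = e(T(j(Φρ̄(res τ))))` (so the values are
`e`-images of `(p²−1)`-th roots of unity of `ℤ̄_p` with residue `j(Φρ̄(res τ))`); and `χ` is unramified at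
every place of `K` over a good prime `ℓ ≠ p` of `W`.
[cite: SerreLocalFields1979, Ch. II §4 Prop. 8] [cite: SilvermanAEC2009, Prop. VII.4.1(a)] -/
theorem exists_framedArtinRep_teichmuller (hk : IsField k) (h2 : Module.finrank (ZMod p) k = 2)
    (hKU : ∀ τ : absoluteGaloisGroup K,
      Φ (galoisRepTorsion W p (absGaloisRestrict ℚ K τ)) ∈ Serre1972.unitGroup k)
    (j : k →+* padicAlgClResidueField p) (e : PadicAlgCl p ≃+* ℂ) :
    ∃ (T : padicAlgClResidueField p → padicAlgClIntegers p) (χ : FramedArtinRep K 1),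
      (∀ z, z ^ (p ^ 2 - 1) = 1 →
        (T z : PadicAlgCl p) ^ (p ^ 2 - 1) = 1 ∧ IsLocalRing.residue (padicAlgClIntegers p) (T z) = z) ∧
      (∀ τ : absoluteGaloisGroup K,
        (j ⟨(Φ (galoisRepTorsion W p (absGaloisRestrict ℚ K τ)) : Matrix (Fin 2) (Fin 2) (ZMod p)), hKU τ⟩) ^
          (p ^ 2 - 1) = 1) ∧
      (∀ τ : absoluteGaloisGroup K,
        ((FramedRep.det χ τ : ℂˣ) : ℂ) =
          e (T (j ⟨(Φ (galoisRepTorsion W p (absGaloisRestrict ℚ K τ)) : Matrix (Fin 2) (Fin 2) (ZMod p)), hKU τ⟩))) ∧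
      (∀ (ℓ : ℕ) [Fact ℓ.Prime], ℓ ≠ p → W.HasGoodReductionAtPrime ℓ →
        ∀ w : HeightOneSpectrum (𝓞 K), (ℓ : 𝓞 K) ∈ w.asIdeal → χ.IsUnramifiedAt w) := by
  have hp : p.Prime := Fact.out
  have hn0 : 0 < p ^ 2 - 1 := by
    have h2le : 2 ≤ p := hp.two_le
    have : 4 ≤ p ^ 2 := by nlinarith
    omega
  have hpn : ¬ p ∣ p ^ 2 - 1 := by
    intro h
    have h1 : p ∣ p ^ 2 := dvd_pow_self p two_ne_zero
    have h4 : 1 ≤ p ^ 2 := Nat.one_le_pow _ _ hp.pos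
    have : p ∣ p ^ 2 - (p ^ 2 - 1) := Nat.dvd_sub h1 h
    rw [Nat.sub_sub_self h4] at this
    exact hp.one_lt.ne' (Nat.dvd_one.mp this)
  obtain ⟨T, hT0, hT1, hT, hTmul⟩ := exists_teichmullerSection (p := p) hn0 hpn
  -- the `k`-valued character and its Teichmüller lift
  let y : absoluteGaloisGroup K → k := fun τ ↦
    ⟨(Φ (galoisRepTorsion W p (absGaloisRestrict ℚ K τ)) : Matrix (Fin 2) (Fin 2) (ZMod p)), hKU τ⟩
  have hy_one : y 1 = 1 := Subtype.ext (by simp [y])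
  have hy_mul : ∀ σ τ, y (σ * τ) = y σ * y τ := fun σ τ ↦ Subtype.ext (by simp [y])
  have hy_pow : ∀ τ, y τ ^ (p ^ 2 - 1) = 1 := fun τ ↦ pow_card_sub_one_coe_eq_one hk h2 (hKU τ)
  have hjy_pow : ∀ τ, j (y τ) ^ (p ^ 2 - 1) = 1 := fun τ ↦ by rw [← map_pow, hy_pow, map_one]
  let θ₀ : absoluteGaloisGroup K →* ℂ :=
    { toFun := fun τ ↦ e (T (j (y τ)) : PadicAlgCl p)
      map_one' := by
        change e (T (j (y 1)) : PadicAlgCl p) = 1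
        rw [hy_one, map_one, hT1, OneMemClass.coe_one, map_one]
      map_mul' := fun σ τ ↦ by
        change e (T (j (y (σ * τ))) : PadicAlgCl p) = e (T (j (y σ)) : PadicAlgCl p) * e (T (j (y τ)) : PadicAlgCl p)
        rw [hy_mul, map_mul, hTmul _ _ (hjy_pow σ) (hjy_pow τ), Subring.coe_mul, map_mul] }
  have hθ₀ : ∀ τ, θ₀ τ = e (T (j (y τ)) : PadicAlgCl p) := fun _ ↦ rfl
  let θ : absoluteGaloisGroup K →* ℂˣ := θ₀.toHomUnits
  have hθ : ∀ τ, ((θ τ : ℂˣ) : ℂ) = e (T (j (y τ)) : PadicAlgCl p) := fun _ ↦ rfl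
  -- open kernel: it contains `res⁻¹(ker ρ̄)`
  have hker : IsOpen (θ.ker : Set (absoluteGaloisGroup K)) := by
    have hO : IsOpen (((galoisRepTorsion W p).ker.comap (absGaloisRestrict ℚ K).toMonoidHom :
        Subgroup (absoluteGaloisGroup K)) : Set (absoluteGaloisGroup K)) :=
      (isOpen_ker_galoisRepTorsion_holds W (by exact_mod_cast hp.ne_zero)).preimage
        (absGaloisRestrict ℚ K).continuous
    refine Subgroup.isOpen_mono ?_ hO
    intro τ hτ
    rw [Subgroup.mem_comap, MonoidHom.mem_ker] at hτ
    rw [MonoidHom.mem_ker]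
    ext
    rw [hθ, Units.val_one]
    have hτ' : galoisRepTorsion W p (absGaloisRestrict ℚ K τ) = 1 := hτ
    have hg : Φ (galoisRepTorsion W p (absGaloisRestrict ℚ K τ)) = 1 := by rw [hτ', map_one]
    have hy1 : y τ = 1 := Subtype.ext (by simp only [y, hg, Units.val_one, OneMemClass.coe_one])
    rw [hy1, map_one, hT1, OneMemClass.coe_one, map_one]
  let χ : FramedArtinRep K 1 := FramedGaloisRep.ofOpenKer θ hker
  have hdet : ∀ τ, ((FramedRep.det χ τ : ℂˣ) : ℂ) = e (T (j (y τ)) : PadicAlgCl p) := by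
    intro τ
    rw [FramedRep.det_apply, Matrix.GeneralLinearGroup.val_det_apply, Matrix.det_fin_one,
      FramedGaloisRep.ofOpenKer_apply_coe, hθ]
  refine ⟨T, χ, hT, hjy_pow, hdet, ?_⟩
  -- unramified over the good primes `ℓ ≠ p`
  intro ℓ _ hℓp hgood w hℓw 𝔓 h𝔓 τ hτ
  -- the prime `𝔔 = 𝔓 ∩ \bar ℤ_ℚ` lies over `ℓ`, and `res τ ∈ I_𝔔`
  set u : HeightOneSpectrum (𝓞 ℚ) := w.under (𝓞 ℚ) with hudef
  have hℓu : (ℓ : 𝓞 ℚ) ∈ u.asIdeal := by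
    rw [hudef, HeightOneSpectrum.under_asIdeal, Ideal.under_def, Ideal.mem_comap, map_natCast]
    exact hℓw
  have hu : (primesEquiv u : ℕ) = ℓ := primesEquiv_eq_of_natCast_mem Fact.out hℓu
  have hw : w.asIdeal.under (𝓞 ℚ) = u.asIdeal := (HeightOneSpectrum.under_asIdeal (𝓞 ℚ) w).symm
  have h𝔔 : 𝔓.comap (absIntegersMap ℚ K) ∈ u.primesAbove := comap_absIntegersMap_mem_primesAbove hw h𝔓
  have hres : absGaloisRestrict ℚ K τ ∈ (𝔓.comap (absIntegersMap ℚ K)).inertia (absoluteGaloisGroup ℚ) :=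
    absGaloisRestrict_mem_inertia_comap ℚ K hτ
  have h1 : galoisRepTorsion W p (absGaloisRestrict ℚ K τ) = 1 :=
    W.galoisRepTorsion_eq_one_of_mem_inertia_prime p hℓp hgood hu h𝔔 hres
  -- hence `χ τ = 1`
  change (χ : absoluteGaloisGroup K →ₜ* GL (Fin 1) ℂ) τ = 1
  rw [show (χ : absoluteGaloisGroup K →ₜ* GL (Fin 1) ℂ) τ = FramedGaloisRep.ofOpenKer θ hker τ from rfl,
    FramedGaloisRep.ofOpenKer_apply_eq_one_iff]
  ext
  rw [hθ, Units.val_one]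
  have hg : Φ (galoisRepTorsion W p (absGaloisRestrict ℚ K τ)) = 1 := by rw [h1, map_one]
  have hy1 : y τ = 1 := Subtype.ext (by simp only [y, hg, Units.val_one, OneMemClass.coe_one])
  rw [hy1, map_one, hT1, OneMemClass.coe_one, map_one]

/-- **The Hecke character of the dihedral constituent** (S4: Artin reciprocity for `K`, tree theorem
`Automorphic.artinReciprocity_character_primitive_holds`).  With the data of
`exists_framedArtinRep_teichmuller`: there are a Teichmüller section `T`, the Artin character `χ`, and a
FINITE-ORDER Hecke character `η` of `K`, unramified exactly where `χ` is (in particular at every place over a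
good prime `ℓ ≠ p` of `W`), whose value at the uniformiser of every such place `v` is
`η(ϖ_v) = e(T(j(Φ(ρ̄(res Frob_v)))))` for every arithmetic Frobenius `Frob_v` at every prime of `\bar ℤ_K`
above `v`. [cite: NeukirchANT1999, Ch. VII §10 Thm. (10.6), Ch. VI Cor. (6.6)]
[cite: CasselsFrohlichANT1967, Ch. VII §5.1] -/
theorem exists_heckeCharacter_teichmuller (hk : IsField k) (h2 : Module.finrank (ZMod p) k = 2)
    (hKU : ∀ τ : absoluteGaloisGroup K,
      Φ (galoisRepTorsion W p (absGaloisRestrict ℚ K τ)) ∈ Serre1972.unitGroup k)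
    (j : k →+* padicAlgClResidueField p) (e : PadicAlgCl p ≃+* ℂ) :
    ∃ (T : padicAlgClResidueField p → padicAlgClIntegers p) (χ : FramedArtinRep K 1) (η : HeckeCharacter K),
      (∀ z, z ^ (p ^ 2 - 1) = 1 →
        (T z : PadicAlgCl p) ^ (p ^ 2 - 1) = 1 ∧ IsLocalRing.residue (padicAlgClIntegers p) (T z) = z) ∧
      (∀ τ : absoluteGaloisGroup K,
        (j ⟨(Φ (galoisRepTorsion W p (absGaloisRestrict ℚ K τ)) : Matrix (Fin 2) (Fin 2) (ZMod p)), hKU τ⟩) ^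
          (p ^ 2 - 1) = 1) ∧
      (∀ τ : absoluteGaloisGroup K,
        ((FramedRep.det χ τ : ℂˣ) : ℂ) =
          e (T (j ⟨(Φ (galoisRepTorsion W p (absGaloisRestrict ℚ K τ)) : Matrix (Fin 2) (Fin 2) (ZMod p)), hKU τ⟩))) ∧
      (∀ (ℓ : ℕ) [Fact ℓ.Prime], ℓ ≠ p → W.HasGoodReductionAtPrime ℓ →
        ∀ w : HeightOneSpectrum (𝓞 K), (ℓ : 𝓞 K) ∈ w.asIdeal → χ.IsUnramifiedAt w) ∧
      η.IsFiniteOrder ∧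
      (∀ v : HeightOneSpectrum (𝓞 K), η.IsUnramifiedAt v ↔ χ.IsUnramifiedAt v) ∧
      (∀ v : HeightOneSpectrum (𝓞 K), χ.IsUnramifiedAt v →
        ∀ 𝔓 ∈ v.primesAbove, ∀ F : absoluteGaloisGroup K, IsArithFrobAt (𝓞 K) F 𝔓 →
          η.valueAtUniformizer v =
            e (T (j ⟨(Φ (galoisRepTorsion W p (absGaloisRestrict ℚ K F)) : Matrix (Fin 2) (Fin 2) (ZMod p)), hKU F⟩))) := by
  obtain ⟨T, χ, hT, hjpow, hdet, hunr⟩ := exists_framedArtinRep_teichmuller W p Φ K hk h2 hKU j e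
  obtain ⟨η, hfin, hη⟩ := Literature.NumberTheory.Automorphic.artinReciprocity_character_primitive_holds (K := K) χ
  refine ⟨T, χ, η, hT, hjpow, hdet, hunr, hfin, fun v ↦ (hη v).1, fun v hv 𝔓 h𝔓 F hF ↦ ?_⟩
  rw [(hη v).2 hv 𝔓 h𝔓 F hF, hdet]

end Artin

end Summit.BirchSwinnertonDyer.BirchSwinnertonDyer.Theorems.SmallImageLambdaLowerThreeNsThetaPartner

end
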